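import Mathlib.Data.List.Sublists
import Mathlib.Data.List.Sort
import Mathlib.Data.List.Perm.Basic
import HarnessLib

/-!
# Volkov's forest formula for the lepton anomalous magnetic moment: the printed operator case tables of 2015, 2017–2019 and 2023/2024, typed verbatim, with `decide` certificates (rows partition the admissible positions; the 2023 seven-case table reduces to the 2017–2019 four-case table on graphs without lepton loops; three printed worked examples are exactly the forest-formula sums)

independent recomputation; certified where stated, statistical where stated; no new-physics claim.

CITATION HEADER (venture `QEDPrecision`, cell `pub-qed`; literature seat gen 21; VALUE-FREE: this file types OPERATOR SYMBOLS, SET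
DEFINITIONS and CASE TABLES only — no coefficient of any order, nothing per graph / per family). Sources (LaTeX e-prints held by the cell under
HOME `data/lit/sources/.cache/<arXiv id>/`, page/line sheet HOME `irse/lit/VOLKOV-IR-EXTRACT-lit.md`):
* [Volkov2024PRD109] S. Volkov, "Calculation of lepton magnetic moments in quantum electrodynamics: A justification of the flexible divergence
  elimination method", Phys. Rev. D 109, 036012 (2024) = arXiv:2308.11560v4, §II "The method formulation" (tex `method_details_2023.tex`
  l.213–364; arXiv-PDF p.5–8; printed equation numbers (8)–(15)). VERBATIM: "A set of subgraphs of a graph is called a forest if any two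
  elements of this set do not overlap. For a vertexlike graph G, we denote by 𝔉[G] the set of all forests F consisting of UV-divergent subgraphs
  of G and satisfying the condition G ∈ F. The lepton path of a graph G connecting its external lepton lines is called the main path of G. By
  I[G] we denote [footnote: The definition differs from that in [69].] the set of all vertexlike subgraphs of G (including G) which have the
  vertex incident to the external photon of G and at least one vertex of the main path of G." … "The expression for the subtraction and
  extraction of the AMM corresponding to a Feynman graph G is  Σ_{F={G₁,…,G_n}∈𝔉[G], G′∈I[G]∩F} (−1)^{n−1} S^{G′}_{G₁} … S^{G′}_{G_n},  where
    S^{G′}_{G″} = A_{G″}, if G″ = G′;  L_{G″} − (U₁)_{G″}, if G″ = G ≠ G′;  L_{G″}, if G′ ⊂ G″ ⊂ G;  (U_ξ)_{G″}, if G″ ∈ I[G] and G″ ⊂ G′;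
    (U₁)_{G″}, if G″ ∉ I[G] and G″ has its external leptons on the main path of G;  (U₂)_{G″}, if G″ has its external leptons on a lepton loop
    of G;  (U₀)_{G″}, if G″ is a photon self-energy or photon-photon scattering subgraph;
  here (15) ξ = 3, if the vertex incident to the external photon of the whole graph G lies on a lepton loop of G, 1 otherwise; the index of an
  operator denotes the subgraph to whose Feynman amplitude it is applied; G₁ ⊂ G₂ or G₁ ⊆ G₂ means V(G₁) ⊂ V(G₂) or V(G₁) ⊆ V(G₂), where V(G)
  denotes the set of vertices of G. We emphasize that the whole graph G is used in the definition of ξ; thus, ξ does not depend on G′ and G″."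
  (`S23` below; `⊂` = proper inclusion, as the distinction `⊂`/`⊆` in the same sentence shows). Worked example, Fig. 1 (tex l.337–344):
  "[A_G(1 − (U₃)_{G_e}) − (L_G − (U₁)_G) A_{G_e}] × (1 − (U₂)_{G_c}) × (1 − (U₁)_{e₂e₄e₅}) × (1 − (U₀)_{G_d}) × (1 − (U₀)_{c₁c₂c₃c₄})
  × (1 − (U₂)_{c₁c₂c₃} − (U₂)_{c₁c₃c₄}) × (1 − (U₂)_{a₁a₂}), where G_e = aa₁a₂b₁b₂c₁c₂c₃c₄d₁d₂d₃e₁e₂e₃e₄e₅, G_d = {aa₁a₂b₁b₂c₁c₂c₃c₄d₁d₂d₃},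
  G_c = aa₁a₂b₁b₂c₁c₂c₃c₄, I[G] = {G_e, G}, subdiagrams are denoted by enumeration of their internal vertices; we should expand the
  parentheses to obtain the forest formula." (`fig1_2023`). Also §III l.773–777 / PRD 110, 036001 (2024) §III eq. (6)–(7): in the
  computations U₁ = U₂ = U₃ = U with (UΓ)_μ = a(M²)γ_μ, (UΣ)(p) = r(m²) + s(m²)m + s(M²)(p̂ − m), "In old calculations we used M² = m²"
  [Volkov2024] — not typed here (no operator CONTENT is typed in this file, only the combinatorics of which operator acts where).
* [Volkov2019] S. Volkov, Phys. Rev. D 100, 096004 (2019) = arXiv:1909.08015, §II "DIVERGENCE ELIMINATION" (tex `amm5_arxiv.tex` l.175–286),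
  identical in [Volkov2018] PRD 98, 076018 §II (tex l.448–466, eqs. `eq_rop`, `eq_operators`) and PRD 96, 096018 (2017) §II: "By 𝕴[G] we denote
  the set of all vertexlike subgraphs G′ of G such that G′ contains the vertex that is incident to the external photon line of G. [In
  particular, G ∈ 𝕴[G].]" …  "R^new_G = Σ_{F={G₁,…,G_n}∈𝔉[G], G′∈𝕴[G]∩F} (−1)^{n−1} M^{G′}_{G₁} M^{G′}_{G₂} … M^{G′}_{G_n},
    M^{G′}_{G″} = A_{G′}, if G′ = G″;  U_{G″}, if G″ ∉ 𝕴[G], or G″ ⊊ G′;  L_{G″}, if G″ ∈ 𝕴[G], G′ ⊊ G″, G″ ≠ G;  (L_{G″} − U_{G″}), if G″ = G,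
    G′ ≠ G.
  In this notation, the subscript of an operator symbol denotes the subgraph to which this operator is applied. The coefficient before γ_μ in
  f̃_G is the contribution of G to a_e." (`M19`); worked example (PRD 100 eq. `eq_example_expression`, tex l.277–280): "for the graph G from
  FIG. [2] we will have the following operator expression: [A_G(1 − U_{bcdefghij}) − (L_G − U_G)A_{bcdefghij}](1 − U_{cd})(1 − U_{fghi})(1 − U_{fgh}
  − U_{ghi}). Here the subscripts mean the subgraphs to which the operators are applied (denoted by the enumeration of the vertexes). The
  expression means that we should remove brackets …" (`figPRD100`).
* [Volkov2016] S. Volkov, J. Exp. Theor. Phys. 122, 1008 (2016) (ZhETF 149, 1164) = arXiv:1507.06435v3 §2.2 (tex `amm_article_arxiv.tex`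
  l.271–422, eqs. `eq_rop`, `eq_operators`): the same formula with the forest index carried, "M^{F,G′}_{G″} = A_{G′}, if G′ = G″;  U_{G″}, if
  G″ ∉ 𝕴[G] or G″ ⊆ G′, G″ ≠ G′;  L_{G″}, if G″ ∈ 𝕴[G], G′ ⊆ G″, G″ ≠ G, G″ ≠ G′;  (L_{G″} − U_{G″}), if G″ = G, G′ ≠ G." (`M15`), and its
  worked example (tex l.388–415): "𝕴[G] = {G_c, G_e, G}, where G_c = aa₁a₂b₁b₂c₁c₂c₃c₄, G_e = aa₁a₂b₁b₂c₁c₂c₃c₄d₁d₂d₃e₁e₂e₃ (subgraphs are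
  specified by enumeration of vertices). Also, there are following UV-divergent subgraphs: a₁a₂ (electron self-energy), c₁c₂c₃, c₁c₃c₄
  (vertex-like, overlapping), c₁c₂c₃c₄ (photon self-energy), G_d = aa₁a₂b₁b₂c₁c₂c₃c₄d₁d₂d₃ (photon-photon scattering). Using (…) we obtain
  f̃_G = [A_G(1 − U_{G_e})(1 − U_{G_d})(1 − U_{G_c}) − (L_G − U_G)A_{G_e}(1 − U_{G_d})(1 − U_{G_c}) − (L_G − U_G)(1 − L_{G_e})(1 − U_{G_d})A_{G_c}]
  × (1 − U_{c₁c₂c₃c₄})(1 − U_{c₁c₂c₃} − U_{c₁c₃c₄})(1 − U_{a₁a₂}) f_G." (`fig1_2015`).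

What is typed, and what the kernel certifies (`decide`; combinatorics of the PRINTED tables and examples only — no physics):
* `Pos` — the position of a forest member G″ relative to (G, G′) as the printed rows read it: G″ = G′?, G″ = G?, G″ ∈ 𝕴[G] (resp. I[G])?,
  G″ ⊊ G′?, G′ ⊊ G″?, and (2023 only) where G″'s external leptons lie (main path / a lepton loop) or whether G″ is photonic. `M15`, `M19`,
  `S23 ξ` — the three printed case tables as ordered row lists (operator symbol, printed condition), conditions transcribed literally.
* `Adm0` / `Adm` — the constraints a position of an actual forest member satisfies, each a one-line consequence of the printed definitions
  (docstrings): e.g. two members of 𝕴[G] (I[G]) in one forest are nested, because both are one-particle-irreducible subgraphs containing the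
  vertex of the external photon, hence both contain the two lepton lines at that vertex, hence they share lines and, not overlapping, are nested.
  ⟦This is the seat's reading of the printed definitions, stated as the HYPOTHESIS of the partition theorems — not a formalised graph theory.⟧
  `adm_counts`: 8 order patterns / 11 positions out of 2⁸.
* `M19_partition`, `M15_partition` (under the order constraints `Adm0`), `S23_partition` (under `Adm`) — EXACTLY ONE printed row fires: the
  rows of each table are mutually exclusive and exhaustive, the printed "cases" are definitions. `M15_eq_M19` — the 2015 rows (with ⊆, ≠) and
  the 2017–2019 rows (with ⊊) select the same operator. `S23_needs_2023_I` — the 2023 table is NOT single-valued at the position "G′ ∈ 𝕴[G]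
  strictly inside a photonic G″", which the 2015 definition of 𝕴 allows on graphs with lepton loops (its own worked example: G_c ⊊ G_d) and the
  2023 definition of I[G] ("… and at least one vertex of the main path") excludes — a kernel-visible reason for the footnote "The definition
  differs from that in [69]".
* `S23_noLoops_eq_M19` — THE DELTA FOR GRAPHS WITHOUT LEPTON LOOPS: if G″ has its external leptons on the main path and is not photonic (which is
  the case for every UV-divergent subgraph of a graph without lepton loops) and ξ = 1 (the external-photon vertex is on the main path), the 2023
  table selects, row for row, the 2017–2019 operator with U ↦ U₁ and (L − U) ↦ (L − U₁): the COMBINATORICS of the 2019 (PRD 100) and 2024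
  (PRD 110) no-lepton-loop computations are identical; the printed difference between them lies inside U only (the subtraction point M², PRD 110
  §III) — cf. HOME `pub-qed-int-2/VOLKOV-IR-ASPRINTED-int2.md` §4, here a kernel fact about the printed tables.
* `figPRD100_eq_forest`, `fig1_2015_eq_forest`, `fig1_2023_eq_forest` — each printed worked example, with its parentheses removed (`expand`), is
  EXACTLY (as a multiset of signed operator assignments) the forest-formula sum `forestTerms` computed from the printed subgraph data (vertex
  lists ⇒ inclusions; the printed overlapping pair; 𝕴/I membership as printed; for Fig. 1 of PRD 109 the lepton-loop / photonic attributes as its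
  operator subscripts state them) with the respective printed table: 36, 192 and 288 signed terms; in particular the signs (−1)^{n−1}, the
  bracket `[A_G(1 − …) − (L_G − U_G)A_{G′} …]` structure (one A per term, L on the 𝕴-members strictly between G′ and G, L − U on G when G′ ≠ G) and
  the 2023 assignments U₃ = U_ξ (ξ = 3: "the vertex incident to the external photon … lies on a lepton loop"), U₂, U₁, U₀ all agree with the tables.
* (append) `table2_2016_eq_forest`, `sec3_2023_twoLoop_eq_forest`, `sec3_2023_U3_eq_forest`, `fig2_2023_eq_forest` — the remaining printed
  operator expressions (JETP 2016 Table 2, all seven 2-loop graphs; PRD 109 §III's ladder / self-energy / U₃ examples and §II Fig. 2) are the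
  forest-formula sums of their tables, so EVERY operator expression printed in JETP 122 §2–§3, PRD 100 §II and PRD 109 §II–§III is certified.
NOT claimed: anything about the operators' analytic content, finiteness of the resulting integrals, or values.
-/

namespace Literature.MathematicalPhysics.QuantumFieldTheory.Volkov2024PRD109

/-! ## Operator symbols and positions -/

/-- The operator SYMBOLS occurring in the printed case tables: `A` (AMM projector), `L` (on-shell vertex renormalisation), `U` (Volkov's
2015–2019 intermediate operator), `LsubU` = (L − U); and the 2023 family `U0`, `U1`, `U2`, `U3`, `LsubU1` = (L − U₁).
[cite: Volkov2024PRD109, §II; Volkov2019, §II] -/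
inductive Op
  | A | L | U | LsubU | U0 | U1 | U2 | U3 | LsubU1
  deriving DecidableEq, Repr

/-- The position of a forest member `G″` relative to the whole graph `G` and the chosen `G′ ∈ 𝕴[G] ∩ F` (resp. `I[G] ∩ F`), as read by the
printed rows: `eqGp` = "G″ = G′", `eqG` = "G″ = G", `inI` = "G″ ∈ 𝕴[G]" (2015–2019) / "G″ ∈ I[G]" (2023), `inGp` = "G″ ⊊ G′" (V(G″) ⊊ V(G′)),
`supGp` = "G′ ⊊ G″", and the 2023 attributes `main` = "G″ has its external leptons on the main path of G", `loop` = "G″ has its external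
leptons on a lepton loop of G", `phot` = "G″ is a photon self-energy or photon-photon scattering subgraph".
[cite: Volkov2024PRD109, §II eq. after (14) and (15); Volkov2019, §II] -/
structure Pos where
  /-- G″ = G′ -/
  eqGp : Bool
  /-- G″ = G -/
  eqG : Bool
  /-- G″ ∈ 𝕴[G] (resp. I[G]) -/
  inI : Bool
  /-- G″ ⊊ G′ -/
  inGp : Bool
  /-- G′ ⊊ G″ -/
  supGp : Bool
  /-- external leptons of G″ on the main path of G -/
  main : Bool
  /-- external leptons of G″ on a lepton loop of G -/
  loop : Bool
  /-- G″ is a photon self-energy or photon-photon scattering subgraph -/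
  phot : Bool
  deriving DecidableEq, Repr

/-- A printed case table = an ordered list of rows (operator symbol, printed condition on the position). (plumbing) [folklore] -/
abbrev Table := List (Op × (Pos → Bool))

/-- The operator symbols of the rows of `t` whose printed condition holds at `p` (in row order). (plumbing) [folklore] -/
def fires (t : Table) (p : Pos) : List Op := (t.filter fun r => r.2 p).map Prod.fst

/-- The operator a table assigns to a position: the first firing row (`none` if no row fires). (plumbing) [folklore] -/
def opOf (t : Table) (p : Pos) : Option Op := (fires t p).head?

/-- All 2⁸ positions (used only to COUNT admissible ones). (plumbing) [folklore] -/
def allBool8 : List Pos :=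
  [true, false].flatMap fun a => [true, false].flatMap fun b => [true, false].flatMap fun c => [true, false].flatMap fun d =>
    [true, false].flatMap fun e => [true, false].flatMap fun f => [true, false].flatMap fun g => [true, false].map fun h =>
      (⟨a, b, c, d, e, f, g, h⟩ : Pos)

/-! ## The three printed tables, verbatim -/

/-- PRD 100, 096004 (2019) §II = PRD 98, 076018 (2018) eq. `eq_operators` = PRD 96, 096018 (2017): "M^{G′}_{G″} = A_{G′}, if G′ = G″;
U_{G″}, if G″ ∉ 𝕴[G], or G″ ⊊ G′; L_{G″}, if G″ ∈ 𝕴[G], G′ ⊊ G″, G″ ≠ G; (L_{G″} − U_{G″}), if G″ = G, G′ ≠ G."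
[cite: Volkov2019, §II; Volkov2018, §II eq. (eq_operators)] -/
def M19 : Table :=
  [ (Op.A,     fun p => p.eqGp),
    (Op.U,     fun p => !p.inI || p.inGp),
    (Op.L,     fun p => p.inI && p.supGp && !p.eqG),
    (Op.LsubU, fun p => p.eqG && !p.eqGp) ]

/-- JETP 122, 1008 (2016) = arXiv:1507.06435v3 §2.2 eq. `eq_operators`: "M^{F,G′}_{G″} = A_{G′}, if G′ = G″; U_{G″}, if G″ ∉ 𝕴[G] or G″ ⊆ G′,
G″ ≠ G′; L_{G″}, if G″ ∈ 𝕴[G], G′ ⊆ G″, G″ ≠ G, G″ ≠ G′; (L_{G″} − U_{G″}), if G″ = G, G′ ≠ G." (`G″ ⊆ G′` read as `G″ ⊊ G′ ∨ G″ = G′`).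
[cite: Volkov2016, §2.2 eq. (eq_operators)] -/
def M15 : Table :=
  [ (Op.A,     fun p => p.eqGp),
    (Op.U,     fun p => !p.inI || ((p.inGp || p.eqGp) && !p.eqGp)),
    (Op.L,     fun p => p.inI && (p.supGp || p.eqGp) && !p.eqG && !p.eqGp),
    (Op.LsubU, fun p => p.eqG && !p.eqGp) ]

/-- PRD 109, 036012 (2024) §II, the seven-case table: "S^{G′}_{G″} = A_{G″}, if G″ = G′; L_{G″} − (U₁)_{G″}, if G″ = G ≠ G′; L_{G″}, if
G′ ⊂ G″ ⊂ G; (U_ξ)_{G″}, if G″ ∈ I[G] and G″ ⊂ G′; (U₁)_{G″}, if G″ ∉ I[G] and G″ has its external leptons on the main path of G; (U₂)_{G″}, if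
G″ has its external leptons on a lepton loop of G; (U₀)_{G″}, if G″ is a photon self-energy or photon-photon scattering subgraph", with (15)
"ξ = 3, if the vertex incident to the external photon of the whole graph G lies on a lepton loop of G, 1 otherwise" — the parameter `xi3`
(`true` ↔ ξ = 3). [cite: Volkov2024PRD109, §II eq. (15) and the display before it] -/
def S23 (xi3 : Bool) : Table :=
  [ (Op.A,      fun p => p.eqGp),
    (Op.LsubU1, fun p => p.eqG && !p.eqGp),
    (Op.L,      fun p => p.supGp && !p.eqG),
    ((if xi3 then Op.U3 else Op.U1), fun p => p.inI && p.inGp),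
    (Op.U1,     fun p => !p.inI && p.main),
    (Op.U2,     fun p => p.loop),
    (Op.U0,     fun p => p.phot) ]

/-! ## Admissible positions and the partition theorems -/

/-- ORDER constraints satisfied by the position of any member `G″` of a forest `F ∈ 𝔉[G]` relative to `G` and `G′ ∈ 𝕴[G] ∩ F` (2015–2019
definition of 𝕴) or `G′ ∈ I[G] ∩ F` (2023 definition), as consequences of the printed definitions ⟦the seat's reading, taken as HYPOTHESIS⟧:
(1) `G″ = G′ ⇒ G″ ∈ 𝕴[G]` and neither `G″ ⊊ G′` nor `G′ ⊊ G″`;  (2) `G″ = G ⇒ G″ ∈ 𝕴[G]` ("In particular, G ∈ 𝕴[G]" / "(including G)") and not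
`G″ ⊊ G′`;  (3) `G″ = G ≠ G′ ⇒ G′ ⊊ G″`;  (4) not both `G″ ⊊ G′` and `G′ ⊊ G″`;  (6) `G″ ∈ 𝕴[G], G″ ≠ G′ ⇒ G″ ⊊ G′ ∨ G′ ⊊ G″` — two members of
𝕴[G] (either definition) are one-particle-irreducible subgraphs containing the vertex of the external photon, whose only lines in G are the two
lepton lines there, so both contain these two lines; members of one forest do not overlap ("not contained in each other and the intersection of
their line sets is not empty"), hence they are nested. [cite: Volkov2024PRD109, §II definitions; Volkov2019, §II definitions and footnotes;
Volkov2016, §2.2] -/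
def Adm0 (p : Pos) : Bool :=
  (!p.eqGp || (p.inI && !p.inGp && !p.supGp)) &&
  (!p.eqG || (p.inI && !p.inGp)) &&
  (!(p.eqG && !p.eqGp) || p.supGp) &&
  !(p.inGp && p.supGp) &&
  (!(p.inI && !p.eqGp) || (p.inGp || p.supGp))

/-- `Adm0` plus the constraints that follow from the 2023 definitions of I[G] and "main path" (PRD 109 §II) on ANY graph, and equally from the
2015–2019 definitions on a graph WITHOUT lepton loops (the scope of PRD 96 / 98 / 100, where every UV-divergent subgraph is a lepton self-energy
or vertexlike subgraph sitting on the main path) ⟦reading, taken as HYPOTHESIS⟧:  (5) `G′ ⊊ G″ ⇒ G″ ∈ I[G]` — G″ then contains the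
external-photon vertex (so it has an external photon) and a main-path vertex of G′ (so the main path enters and leaves it: two external
leptons), hence is vertexlike with both properties;  (7) exactly one of: photonic / external leptons on the main path / external leptons on a
lepton loop (a lepton self-energy or vertexlike subgraph has two external lepton lines, the two ends of a segment of ONE lepton line of G);
(8) `G″ ∈ I[G] ⇒` external leptons on the main path (as in (5)). For the 2015 𝕴 on a graph WITH lepton loops (5) and (8) can fail — see
`S23_needs_2023_I`. [cite: Volkov2024PRD109, §II definitions and footnote "The definition differs from that in [69]"] -/
def Adm (p : Pos) : Bool :=
  Adm0 p &&
  (!p.supGp || p.inI) &&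
  (if p.phot then (!p.main && !p.loop) else (p.main != p.loop)) &&
  (!p.inI || p.main)

/-- The eight order patterns allowed by `Adm0` and the eleven positions allowed by `Adm`, out of 2⁸ (a count of the typed constraints, for the reader).
[cite: Volkov2024PRD109, §II definitions of forest, main path, I[G]] -/
theorem adm_counts :
    ((allBool8.filter fun p => Adm0 p).map (fun p => (p.eqGp, p.eqG, p.inI, p.inGp, p.supGp))).dedup.length = 8 ∧
    (allBool8.filter Adm).length = 11 := by decide +kernel

/-- PRD 100 / PRD 98 / PRD 96: on every position allowed by the order constraints exactly one of the four printed rows fires — the printed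
"cases" are mutually exclusive and exhaustive. [cite: Volkov2019, §II; Volkov2018, §II eq. (eq_operators)] -/
theorem M19_partition : ∀ p : Pos, Adm0 p = true → (fires M19 p).length = 1 := by
  intro p; cases p with
  | mk a b c d e f g h => revert a b c d e f g h; decide

/-- JETP 122, 1008 (2016): likewise for the four 2015 rows. [cite: Volkov2016, §2.2 eq. (eq_operators)] -/
theorem M15_partition : ∀ p : Pos, Adm0 p = true → (fires M15 p).length = 1 := by
  intro p; cases p with
  | mk a b c d e f g h => revert a b c d e f g h; decide

/-- The 2015 rows (`⊆`, `≠`) and the 2017–2019 rows (`⊊`) select the same operator on every position allowed by the order constraints.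
[cite: Volkov2016, §2.2; Volkov2019, §II] -/
theorem M15_eq_M19 : ∀ p : Pos, Adm0 p = true → fires M15 p = fires M19 p := by
  intro p; cases p with
  | mk a b c d e f g h => revert a b c d e f g h; decide

/-- PRD 109, 036012 §II: for either value of ξ, on every admissible position exactly one of the seven printed rows fires.
[cite: Volkov2024PRD109, §II eq. (15) and the display before it] -/
theorem S23_partition (xi3 : Bool) : ∀ p : Pos, Adm p = true → (fires (S23 xi3) p).length = 1 := by
  intro p; cases p with
  | mk a b c d e f g h => revert xi3 a b c d e f g h; decide

/-- Why PRD 109 changed the definition of I[G] (footnote "The definition differs from that in [69]"): with the 2015 𝕴[G] on a graph with lepton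
loops a member G′ ∈ 𝕴[G] may sit strictly inside a PHOTONIC subgraph G″ (in the 2015 worked example, `G_c ∈ 𝕴[G]` and `G_c ⊊ G_d`, G_d the
photon-photon scattering subgraph — `ex2015` below); at that position (allowed by `Adm0`, excluded by `Adm` (5)) the 2015 table fires the single
row U, whereas the 2023 rows "L, if G′ ⊂ G″ ⊂ G" and "(U₀), if G″ is a photon self-energy or photon-photon scattering subgraph" would BOTH fire.
Under the 2023 definition G_c ∉ I[G] (it has no main-path vertex; PRD 109 prints I[G] = {G_e, G} for its Fig. 1), so the position does not occur.
[cite: Volkov2024PRD109, §II; Volkov2016, §2.2] -/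
theorem S23_needs_2023_I (xi3 : Bool) :
    let p : Pos := ⟨false, false, false, false, true, false, false, true⟩
    Adm0 p = true ∧ Adm p = false ∧ fires M15 p = [Op.U] ∧ fires (S23 xi3) p = [Op.L, Op.U0] := by
  cases xi3 <;> decide

/-- The dictionary 2017–2019 → 2023 for graphs without lepton loops: `U ↦ U₁`, `(L − U) ↦ (L − U₁)`, `A ↦ A`, `L ↦ L` (PRD 110, 036001 §III:
"In terms of [PRD 109, 036012], we put U₁ = U₂ = U₃ = U"). [cite: Volkov2024PRD109, §II; Volkov2024, §III] -/
def embed19 : Op → Op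
  | Op.U => Op.U1
  | Op.LsubU => Op.LsubU1
  | o => o

/-- THE DELTA FOR GRAPHS WITHOUT LEPTON LOOPS. If `G″` has its external leptons on the main path (hence, admissibly, is neither photonic nor
on a lepton loop) — the situation of EVERY UV-divergent subgraph of a graph without lepton loops — and ξ = 1 (the external-photon vertex lies on
the main path), then the 2023 seven-case table fires exactly the 2017–2019 operator translated by `embed19`. Hence the forest formula of PRD 109
/ PRD 110 and the one of PRD 96 / 98 / 100 have identical combinatorics on such graphs; the printed difference between the 2019 and the 2024
no-lepton-loop computations is inside U alone (the subtraction point M², PRD 110 §III eq. (6)–(7)).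
[cite: Volkov2024PRD109, §II; Volkov2019, §II; Volkov2024, §III] -/
theorem S23_noLoops_eq_M19 :
    ∀ p : Pos, (Adm p && p.main) = true → fires (S23 false) p = (fires M19 p).map embed19 := by
  intro p; cases p with
  | mk a b c d e f g h => revert a b c d e f g h; decide

/-- Contrast (ξ = 3 is a lepton-loop situation): with ξ = 3 the member of I[G] strictly inside G′ gets U₃, which is NOT the `embed19`-image
of the 2019 operator U — the only row where ξ matters. [cite: Volkov2024PRD109, §II eq. (15)] -/
theorem S23_xi3_differs :
    fires (S23 true) ⟨false, false, true, true, false, true, false, false⟩ = [Op.U3] ∧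
    fires M19 ⟨false, false, true, true, false, true, false, false⟩ = [Op.U] := by decide

/-! ## Forest-formula expansion of the printed worked examples

A worked example is typed as DATA read off the printed text: the proper UV-divergent subgraphs with their printed vertex lists (inclusion
`⊂` = proper inclusion of vertex sets, as printed), the printed overlapping pair(s), membership in 𝕴[G] / I[G] as printed, and (2023) the
attributes the printed operator subscripts state. The whole graph `G` is member `0`; `G ∈ 𝕴[G]`; every proper subgraph is `⊊ G`. -/

/-- One proper UV-divergent subgraph of a printed worked example: name, printed vertex enumeration ("subdiagrams are denoted by enumeration of
their internal vertices"), printed membership in 𝕴[G] / I[G], and the 2023 attributes (main path / lepton loop / photonic).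
[cite: Volkov2024PRD109, §II, Fig. 1 example; Volkov2016, §2.2, Fig. 1 example] -/
structure Sub where
  /-- printed name -/
  name : String
  /-- printed vertex list -/
  verts : List String
  /-- printed: member of 𝕴[G] (resp. I[G]) -/
  inI : Bool
  /-- 2023 attribute: external leptons on the main path -/
  main : Bool
  /-- 2023 attribute: external leptons on a lepton loop -/
  loop : Bool
  /-- 2023 attribute: photon self-energy or photon-photon scattering subgraph -/
  phot : Bool
  deriving DecidableEq, Repr

/-- A printed worked example: the proper UV-divergent subgraphs (members `1 … n` in this order; member `0` = G) and the printed overlapping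
pairs (by member index; "Two subgraphs are said to overlap if they are not contained in each other and the intersection of their line sets is
not empty"). [cite: Volkov2024PRD109, §II, Fig. 1 example; Volkov2019, §II eq. (eq_example_expression)] -/
structure Example where
  /-- proper UV-divergent subgraphs, printed data -/
  subs : List Sub
  /-- printed overlapping pairs (unordered) -/
  overlaps : List (ℕ × ℕ)
  deriving Repr

namespace Example

variable (ex : Example)

/-- number of proper UV-divergent subgraphs (plumbing) [folklore] -/
def n : ℕ := ex.subs.length

/-- the data of member `i ≥ 1` (plumbing) [folklore] -/
def sub (i : ℕ) : Option Sub := ex.subs[i - 1]?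

/-- proper vertex-set inclusion `i ⊊ j` (member `0` = G contains every proper subgraph strictly; data members by their printed vertex lists:
"G₁ ⊂ G₂ … means V(G₁) ⊂ V(G₂)"). [cite: Volkov2024PRD109, §II, sentence after eq. (15)] -/
def ssub (i j : ℕ) : Bool :=
  if i == j then false
  else if j == 0 then true
  else if i == 0 then false
  else match ex.sub i, ex.sub j with
    | some a, some b => a.verts.all (· ∈ b.verts) && !(b.verts.all (· ∈ a.verts))
    | _, _ => false

/-- printed overlap relation (plumbing) [folklore] -/
def ovl (i j : ℕ) : Bool := ex.overlaps.any fun q => (q.1 == i && q.2 == j) || (q.1 == j && q.2 == i)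

/-- membership in 𝕴[G] / I[G]: `G` itself ("(including G)" / "In particular, G ∈ 𝕴[G]"), and the data members so marked.
[cite: Volkov2024PRD109, §II definition of I[G]; Volkov2019, §II footnote] -/
def memI (i : ℕ) : Bool := if i == 0 then true else match ex.sub i with | some a => a.inI | none => false

/-- the 2023 attributes (main, loop, phot) of member `i`; `G` itself: on the main path (plumbing) [folklore] -/
def attrs (i : ℕ) : Bool × Bool × Bool :=
  if i == 0 then (true, false, false)
  else match ex.sub i with
    | some a => (a.main, a.loop, a.phot)
    | none => (false, false, false)

/-- the position of member `g2` = G″ relative to `G′ = g1` (plumbing) [folklore] -/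
def pos (g1 g2 : ℕ) : Pos :=
  { eqGp := g2 == g1, eqG := g2 == 0, inI := ex.memI g2, inGp := ex.ssub g2 g1, supGp := ex.ssub g1 g2,
    main := (ex.attrs g2).1, loop := (ex.attrs g2).2.1, phot := (ex.attrs g2).2.2 }

/-- the forests `F ∈ 𝔉[G]`: `G` together with any set of proper UV-divergent subgraphs containing no overlapping pair (as the list of proper
members, increasing). [cite: Volkov2024PRD109, §II "A set of subgraphs of a graph is called a forest if any two elements of this set do not
overlap … the set of all forests F consisting of UV-divergent subgraphs of G and satisfying the condition G ∈ F"] -/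
def forests : List (List ℕ) :=
  ((List.range ex.n).map (· + 1)).sublists.filter fun K => K.all fun i => K.all fun j => !(ex.ovl i j)

/-- A signed term: sign and the operator assignment (member index, operator), sorted by member index. (plumbing) [folklore] -/
abbrev Term := Int × List (ℕ × Op)

/-- canonical form of an assignment list (sorted by member index) (plumbing) [folklore] -/
def canon (l : List (ℕ × Op)) : List (ℕ × Op) := l.insertionSort fun a b => a.1 ≤ b.1

/-- The forest-formula sum for table `t`: over forests `F = {G} ∪ K` and `G′ ∈ 𝕴[G] ∩ F`, the term `(−1)^{n−1} ∏_{G″∈F} t(G′, G″)` with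
`n = #F` (an operator `none` — no row fires — is recorded as a missing factor, which the certificates below exclude by exact comparison).
[cite: Volkov2024PRD109, §II; Volkov2019, §II eq. (R^new)] -/
def forestTerms (t : Table) : List Term :=
  ex.forests.flatMap fun K =>
    ((0 :: K).filter ex.memI).map fun g1 =>
      ((if K.length % 2 == 0 then 1 else -1),
        canon ((0 :: K).filterMap fun g2 => (opOf t (ex.pos g1 g2)).map fun o => (g2, o)))

end Example

/-- A printed product of brackets: each factor is a sum of signed monomials, a monomial = a list of (member index, operator). (plumbing) [folklore] -/
abbrev Factor := List (Int × List (ℕ × Op))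

/-- "we should expand the parentheses to obtain the forest formula": the full expansion of a product of factors into signed terms (assignment
lists in canonical order). [cite: Volkov2024PRD109, §II, sentence after the Fig. 1 expression] -/
def expand (fs : List Factor) : List Example.Term :=
  (fs.foldl (fun acc f => acc.flatMap fun t => f.map fun m => (t.1 * m.1, t.2 ++ m.2)) [(1, [])]).map
    fun t => (t.1, Example.canon t.2)

/-! ### PRD 100, 096004 (2019), eq. `eq_example_expression` (graph of its Fig. 2; no lepton loops) -/

/-- The proper UV-divergent subgraphs named in PRD 100's worked expression, by their printed vertex enumerations: 1 = `bcdefghij` (the inner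
member of 𝕴[G]: it carries `A` in the second printed term), 2 = `cd`, 3 = `fghi`, 4 = `fgh`, 5 = `ghi`; `fgh`, `ghi` overlap (they enter one
bracket `(1 − U_{fgh} − U_{ghi})`); no lepton loops (all external leptons on the main path, nothing photonic).
[cite: Volkov2019, §II eq. (eq_example_expression)] -/
def exPRD100 : Example :=
  { subs := [ ⟨"bcdefghij", ["b","c","d","e","f","g","h","i","j"], true, true, false, false⟩,
              ⟨"cd", ["c","d"], false, true, false, false⟩,
              ⟨"fghi", ["f","g","h","i"], false, true, false, false⟩,
              ⟨"fgh", ["f","g","h"], false, true, false, false⟩,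
              ⟨"ghi", ["g","h","i"], false, true, false, false⟩ ],
    overlaps := [(4, 5)] }

/-- VERBATIM: "[A_G(1 − U_{bcdefghij}) − (L_G − U_G)A_{bcdefghij}](1 − U_{cd})(1 − U_{fghi})(1 − U_{fgh} − U_{ghi})" (member 0 = G).
[cite: Volkov2019, §II eq. (eq_example_expression)] -/
def figPRD100 : List Factor :=
  [ [(1, [(0, Op.A)]), (-1, [(0, Op.A), (1, Op.U)]), (-1, [(0, Op.LsubU), (1, Op.A)])],
    [(1, []), (-1, [(2, Op.U)])],
    [(1, []), (-1, [(3, Op.U)])],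
    [(1, []), (-1, [(4, Op.U)]), (-1, [(5, Op.U)])] ]

/-- 24 forests (2⁵ − 2³: the subsets of the five proper subgraphs avoiding the overlapping pair) and 36 signed terms on both sides.
[cite: Volkov2019, §II] -/
theorem figPRD100_counts :
    exPRD100.forests.length = 24 ∧ (exPRD100.forestTerms M19).length = 36 ∧ (expand figPRD100).length = 36 := by decide +kernel

/-- PRD 100's printed operator expression, parentheses removed, is EXACTLY the forest-formula sum of its §II table for the printed subgraph
data (as multisets of signed operator assignments). [cite: Volkov2019, §II eq. (eq_example_expression) and eq. (R^new, M)] -/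
theorem figPRD100_eq_forest : (expand figPRD100).Perm (exPRD100.forestTerms M19) := by decide +kernel

/-- … and, the graph having no lepton loops (ξ = 1), the 2023 table gives the same expansion with U ↦ U₁, (L − U) ↦ (L − U₁).
[cite: Volkov2024PRD109, §II; Volkov2019, §II] -/
theorem figPRD100_eq_forest23 :
    ((expand figPRD100).map fun t => (t.1, t.2.map fun a => (a.1, embed19 a.2))).Perm (exPRD100.forestTerms (S23 false)) := by
  decide +kernel

/-! ### JETP 122, 1008 (2016) = arXiv:1507.06435 §2.2, Figure 1 (a graph WITH lepton loops; 2015 table, 𝕴[G] = {G_c, G_e, G}) -/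

/-- The proper UV-divergent subgraphs of the 2015 worked example with their printed vertex lists and types: 1 = G_e, 2 = G_d (photon-photon
scattering), 3 = G_c, 4 = c₁c₂c₃c₄ (photon self-energy), 5 = c₁c₂c₃, 6 = c₁c₃c₄ ("vertex-like, overlapping"), 7 = a₁a₂ (electron self-energy);
𝕴[G] = {G_c, G_e, G}. (The 2015 table reads only 𝕴-membership and inclusions; the main/loop attributes are not used by it and are set
nominally.) [cite: Volkov2016, §2.2, text before the f̃_G display] -/
def ex2015 : Example :=
  { subs := [ ⟨"G_e", ["a","a1","a2","b1","b2","c1","c2","c3","c4","d1","d2","d3","e1","e2","e3"], true, true, false, false⟩,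
              ⟨"G_d", ["a","a1","a2","b1","b2","c1","c2","c3","c4","d1","d2","d3"], false, false, false, true⟩,
              ⟨"G_c", ["a","a1","a2","b1","b2","c1","c2","c3","c4"], true, true, false, false⟩,
              ⟨"c1c2c3c4", ["c1","c2","c3","c4"], false, false, false, true⟩,
              ⟨"c1c2c3", ["c1","c2","c3"], false, false, true, false⟩,
              ⟨"c1c3c4", ["c1","c3","c4"], false, false, true, false⟩,
              ⟨"a1a2", ["a1","a2"], false, false, true, false⟩ ],
    overlaps := [(5, 6)] }

/-- VERBATIM (2015): "f̃_G = [A_G(1 − U_{G_e})(1 − U_{G_d})(1 − U_{G_c}) − (L_G − U_G)A_{G_e}(1 − U_{G_d})(1 − U_{G_c}) − (L_G − U_G)(1 − L_{G_e})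
(1 − U_{G_d})A_{G_c}] × (1 − U_{c₁c₂c₃c₄})(1 − U_{c₁c₂c₃} − U_{c₁c₃c₄})(1 − U_{a₁a₂}) f_G" — the square bracket typed as one factor of 16 signed
monomials (its three printed products expanded). [cite: Volkov2016, §2.2, the f̃_G display (eqnarray)] -/
def fig1_2015 : List Factor :=
  [ -- A_G (1 − U_{G_e})(1 − U_{G_d})(1 − U_{G_c})
    [(1, [(0, Op.A)]), (-1, [(0, Op.A), (1, Op.U)]), (-1, [(0, Op.A), (2, Op.U)]), (-1, [(0, Op.A), (3, Op.U)]),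
     (1, [(0, Op.A), (1, Op.U), (2, Op.U)]), (1, [(0, Op.A), (1, Op.U), (3, Op.U)]), (1, [(0, Op.A), (2, Op.U), (3, Op.U)]),
     (-1, [(0, Op.A), (1, Op.U), (2, Op.U), (3, Op.U)]),
    -- − (L_G − U_G) A_{G_e} (1 − U_{G_d})(1 − U_{G_c})
     (-1, [(0, Op.LsubU), (1, Op.A)]), (1, [(0, Op.LsubU), (1, Op.A), (2, Op.U)]), (1, [(0, Op.LsubU), (1, Op.A), (3, Op.U)]),
     (-1, [(0, Op.LsubU), (1, Op.A), (2, Op.U), (3, Op.U)]),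
    -- − (L_G − U_G)(1 − L_{G_e})(1 − U_{G_d}) A_{G_c}
     (-1, [(0, Op.LsubU), (3, Op.A)]), (1, [(0, Op.LsubU), (1, Op.L), (3, Op.A)]), (1, [(0, Op.LsubU), (2, Op.U), (3, Op.A)]),
     (-1, [(0, Op.LsubU), (1, Op.L), (2, Op.U), (3, Op.A)])],
    [(1, []), (-1, [(4, Op.U)])],
    [(1, []), (-1, [(5, Op.U)]), (-1, [(6, Op.U)])],
    [(1, []), (-1, [(7, Op.U)])] ]

/-- 96 forests, 192 signed terms on both sides. [cite: Volkov2016, §2.2] -/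
theorem fig1_2015_counts :
    ex2015.forests.length = 96 ∧ (ex2015.forestTerms M15).length = 192 ∧ (expand fig1_2015).length = 192 := by decide +kernel

/-- The 2015 worked example, parentheses removed, is EXACTLY the forest-formula sum of the 2015 table M^{F,G′} for the printed subgraph data
(three A-carrying families: G′ = G, G_e, G_c; `L_{G_e}` exactly in the G′ = G_c terms containing G_e). [cite: Volkov2016, §2.2] -/
theorem fig1_2015_eq_forest : (expand fig1_2015).Perm (ex2015.forestTerms M15) := by decide +kernel

/-! ### PRD 109, 036012 (2024) §II, Fig. 1 (a graph WITH lepton loops; I[G] = {G_e, G}, ξ = 3) -/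

/-- The proper UV-divergent subgraphs of PRD 109's Fig. 1 example with their printed vertex lists; I[G] = {G_e, G} as printed; the attributes
as the printed operator subscripts state them: 1 = G_e (∈ I[G]; carries U₃ = U_ξ, so ξ = 3: the external-photon vertex lies on a lepton loop),
2 = G_c ((U₂): external leptons on a lepton loop), 3 = e₂e₄e₅ ((U₁): ∉ I[G], external leptons on the main path), 4 = G_d ((U₀): photon-photon
scattering), 5 = c₁c₂c₃c₄ ((U₀): photon self-energy), 6 = c₁c₂c₃ and 7 = c₁c₃c₄ ((U₂); overlapping: one bracket), 8 = a₁a₂ ((U₂)).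
[cite: Volkov2024PRD109, §II, Fig. 1 expression and the sentence after it] -/
def ex2023 : Example :=
  { subs := [ ⟨"G_e", ["a","a1","a2","b1","b2","c1","c2","c3","c4","d1","d2","d3","e1","e2","e3","e4","e5"], true, true, false, false⟩,
              ⟨"G_c", ["a","a1","a2","b1","b2","c1","c2","c3","c4"], false, false, true, false⟩,
              ⟨"e2e4e5", ["e2","e4","e5"], false, true, false, false⟩,
              ⟨"G_d", ["a","a1","a2","b1","b2","c1","c2","c3","c4","d1","d2","d3"], false, false, false, true⟩,
              ⟨"c1c2c3c4", ["c1","c2","c3","c4"], false, false, false, true⟩,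
              ⟨"c1c2c3", ["c1","c2","c3"], false, false, true, false⟩,
              ⟨"c1c3c4", ["c1","c3","c4"], false, false, true, false⟩,
              ⟨"a1a2", ["a1","a2"], false, false, true, false⟩ ],
    overlaps := [(6, 7)] }

/-- VERBATIM (2023): "[A_G(1 − (U₃)_{G_e}) − (L_G − (U₁)_G)A_{G_e}] × (1 − (U₂)_{G_c}) × (1 − (U₁)_{e₂e₄e₅}) × (1 − (U₀)_{G_d}) × (1 − (U₀)_{c₁c₂c₃c₄})
× (1 − (U₂)_{c₁c₂c₃} − (U₂)_{c₁c₃c₄}) × (1 − (U₂)_{a₁a₂})". [cite: Volkov2024PRD109, §II, Fig. 1 expression] -/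
def fig1_2023 : List Factor :=
  [ [(1, [(0, Op.A)]), (-1, [(0, Op.A), (1, Op.U3)]), (-1, [(0, Op.LsubU1), (1, Op.A)])],
    [(1, []), (-1, [(2, Op.U2)])],
    [(1, []), (-1, [(3, Op.U1)])],
    [(1, []), (-1, [(4, Op.U0)])],
    [(1, []), (-1, [(5, Op.U0)])],
    [(1, []), (-1, [(6, Op.U2)]), (-1, [(7, Op.U2)])],
    [(1, []), (-1, [(8, Op.U2)])] ]

/-- 192 forests (2⁸ − 2⁶), 288 signed terms on both sides. [cite: Volkov2024PRD109, §II] -/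
theorem fig1_2023_counts :
    ex2023.forests.length = 192 ∧ (ex2023.forestTerms (S23 true)).length = 288 ∧ (expand fig1_2023).length = 288 := by decide +kernel

/-- PRD 109's Fig. 1 expression, parentheses removed, is EXACTLY the forest-formula sum of its seven-case table with ξ = 3 for the printed subgraph
data: every sign, the `[A_G(1 − (U₃)_{G_e}) − (L_G − (U₁)_G)A_{G_e}]` structure and all 2023 operator assignments agree with the printed rows.
[cite: Volkov2024PRD109, §II, Fig. 1 expression, eq. (15) and the S-table] -/
theorem fig1_2023_eq_forest : (expand fig1_2023).Perm (ex2023.forestTerms (S23 true)) := by decide +kernel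

/-- With ξ = 1 instead, the same data would put (U₁)_{G_e} where the paper prints (U₃)_{G_e}: the printed U₃ pins ξ = 3 for this graph.
[cite: Volkov2024PRD109, §II eq. (15)] -/
theorem fig1_2023_xi1_differs : ¬ (expand fig1_2023).Perm (ex2023.forestTerms (S23 false)) := by decide +kernel

/-! ### (append, lit g21) The remaining printed operator expressions: JETP 122 (2016) Table 2 (all seven 2-loop graphs) and PRD 109 §II Fig. 2 / §III examples

Every further operator expression printed in the sources of this file is certified the same way: the expression, parentheses removed, is the
forest-formula sum of the respective table for the subgraph data its own subscripts and the accompanying text state (2-loop graphs have at most one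
proper UV-divergent subgraph). JETP 122, 1008 (2016) = arXiv:1507.06435v3 Table 2 (`table_2loop`, tex l.718–737), column "operator expression",
VERBATIM (the value and N_call columns are NOT typed): «1: $A_G-A_GU_{abc}-(L_G-U_G)A_{abc}$; 2: $A_G$; 3: $A_G-A_GU_{bcd}$; 4: $A_G-A_GU_{bcd}$;
5: $A_G-A_GU_{bc}$; 6: $A_G-A_GU_{bc}$; 7: $A_G-A_GU_{de}$» ("in this table by $G$ we denote the whole graph", tex l.421) — graph 1 the ladder
(inner vertex subgraph abc ∈ 𝕴[G]), graph 2 the crossed graph (no UV-divergent proper subgraph), graphs 3–4 a vertex subgraph bcd ∉ 𝕴[G], graphs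
5–6 an electron self-energy subgraph bc, graph 7 the photon self-energy (vacuum-polarisation) subgraph de (§3: "graph 2 doesn't have divergences,
all UV-divergences in graph 7 are obviously removed … Each of graphs 3--6 has a unique UV-divergent subgraph that doesn't coincide with the whole
graph … In the graph 1 the subgraph $abc$ generates UV and IR divergences simultaneously", tex l.606–628). PRD 109 §III prints the same two
expressions with U ↦ U₁ — «$A_G - A_G (U_1)_{abc} - (L-U_1)_G A_{abc}$» (ladder, tex l.405), «$A_G-A_G (U_1)_{bc}$» (self-energy insertion,
tex l.411) — and the U₃ example «$\left[A_G - A_G (U_3)_{bcdfghi} - (L-U_1)_G A_{bcdfghi}\right] \left( 1- (U_0)_{fghi} \right)$» (tex l.424;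
"the on-shell Feynman amplitude of $bcdfghi$ has no IR divergence, because its external photon is on a lepton loop" ⇒ ξ = 3; fghi a photon
self-energy inside it); PRD 109 §II Fig. 2: «$A_G \left( 1-(U_1)_{cdefghi} \right) \left( 1 - (U_0)_{fghi} \right)$» with "$\infragr[G]=\{G\}$"
and "The operator $U_1$ is applied to the subgraph $cdefghi$, because its external leptons are on the main path of $G$" (tex l.353–357).
-/

/-- JETP 2016 Table 2, graph 1 (ladder): proper UV-divergent subgraph abc ∈ 𝕴[G]. [cite: Volkov2016, Table 2 row 1] -/
def ex2L_ladder : Example := { subs := [⟨"abc", ["a","b","c"], true, true, false, false⟩], overlaps := [] }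
/-- JETP 2016 Table 2, graph 2 (crossed): no UV-divergent proper subgraph. [cite: Volkov2016, Table 2 row 2] -/
def ex2L_crossed : Example := { subs := [], overlaps := [] }
/-- JETP 2016 Table 2, graphs 3–4: a vertex subgraph bcd not containing the external-photon vertex. [cite: Volkov2016, Table 2 rows 3–4] -/
def ex2L_vertex : Example := { subs := [⟨"bcd", ["b","c","d"], false, true, false, false⟩], overlaps := [] }
/-- JETP 2016 Table 2, graphs 5–6: an electron self-energy subgraph bc. [cite: Volkov2016, Table 2 rows 5–6] -/
def ex2L_selfEnergy : Example := { subs := [⟨"bc", ["b","c"], false, true, false, false⟩], overlaps := [] }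
/-- JETP 2016 Table 2, graph 7: the photon self-energy subgraph de (U = Taylor expansion, 2015 definition). [cite: Volkov2016, Table 2 row 7] -/
def ex2L_vacPol : Example := { subs := [⟨"de", ["d","e"], false, false, false, true⟩], overlaps := [] }

/-- Table 2, column "operator expression", rows 1–7 VERBATIM (rows 3 = 4 and 5 = 6 as printed). [cite: Volkov2016, Table 2] -/
def table2_2016 : List (List Factor) :=
  [ [[(1, [(0, Op.A)]), (-1, [(0, Op.A), (1, Op.U)]), (-1, [(0, Op.LsubU), (1, Op.A)])]],   -- 1: A_G − A_G U_abc − (L_G − U_G) A_abc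
    [[(1, [(0, Op.A)])]],                                                                  -- 2: A_G
    [[(1, [(0, Op.A)]), (-1, [(0, Op.A), (1, Op.U)])]],                                    -- 3: A_G − A_G U_bcd
    [[(1, [(0, Op.A)]), (-1, [(0, Op.A), (1, Op.U)])]],                                    -- 4: A_G − A_G U_bcd
    [[(1, [(0, Op.A)]), (-1, [(0, Op.A), (1, Op.U)])]],                                    -- 5: A_G − A_G U_bc
    [[(1, [(0, Op.A)]), (-1, [(0, Op.A), (1, Op.U)])]],                                    -- 6: A_G − A_G U_bc
    [[(1, [(0, Op.A)]), (-1, [(0, Op.A), (1, Op.U)])]] ]                                   -- 7: A_G − A_G U_de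

/-- The seven 2-loop graphs' subgraph data in Table 2's row order. [cite: Volkov2016, Table 2 and §3] -/
def table2_2016_graphs : List Example :=
  [ex2L_ladder, ex2L_crossed, ex2L_vertex, ex2L_vertex, ex2L_selfEnergy, ex2L_selfEnergy, ex2L_vacPol]

/-- Every row of JETP 2016 Table 2 is exactly the forest-formula sum of the 2015 table for its graph (and of the 2017–2019 table alike).
[cite: Volkov2016, Table 2, §2.2 eq. (eq_operators); Volkov2019, §II] -/
theorem table2_2016_eq_forest :
    (List.zip table2_2016 table2_2016_graphs).all
      (fun r => decide ((expand r.1).Perm (r.2.forestTerms M15)) && decide ((expand r.1).Perm (r.2.forestTerms M19))) = true := by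
  decide +kernel

/-- PRD 109 §III, the 2-loop ladder and self-energy examples with U₁: «A_G − A_G (U₁)_{abc} − (L − U₁)_G A_{abc}», «A_G − A_G (U₁)_{bc}» — the
2023 table with ξ = 1 on the same data. [cite: Volkov2024PRD109, §III (2-loop examples)] -/
theorem sec3_2023_twoLoop_eq_forest :
    (expand [[(1, [(0, Op.A)]), (-1, [(0, Op.A), (1, Op.U1)]), (-1, [(0, Op.LsubU1), (1, Op.A)])]]).Perm (ex2L_ladder.forestTerms (S23 false)) ∧
    (expand [[(1, [(0, Op.A)]), (-1, [(0, Op.A), (1, Op.U1)])]]).Perm (ex2L_selfEnergy.forestTerms (S23 false)) := by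
  decide +kernel

/-- PRD 109 §III, the U₃ example (its Fig. 4): 1 = bcdfghi ∈ I[G] (vertexlike, contains the external-photon vertex which lies on a lepton loop ⇒
ξ = 3), 2 = fghi a photon self-energy subgraph inside it. [cite: Volkov2024PRD109, §III (example with U₃)] -/
def exU3 : Example :=
  { subs := [⟨"bcdfghi", ["b","c","d","f","g","h","i"], true, true, false, false⟩, ⟨"fghi", ["f","g","h","i"], false, false, false, true⟩],
    overlaps := [] }

/-- «[A_G − A_G (U₃)_{bcdfghi} − (L − U₁)_G A_{bcdfghi}] (1 − (U₀)_{fghi})» is exactly the 2023 forest sum with ξ = 3 on that data (and NOT with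
ξ = 1). [cite: Volkov2024PRD109, §III (example with U₃)] -/
theorem sec3_2023_U3_eq_forest :
    (expand [[(1, [(0, Op.A)]), (-1, [(0, Op.A), (1, Op.U3)]), (-1, [(0, Op.LsubU1), (1, Op.A)])], [(1, []), (-1, [(2, Op.U0)])]]).Perm
      (exU3.forestTerms (S23 true)) ∧
    ¬ (expand [[(1, [(0, Op.A)]), (-1, [(0, Op.A), (1, Op.U3)]), (-1, [(0, Op.LsubU1), (1, Op.A)])], [(1, []), (-1, [(2, Op.U0)])]]).Perm
      (exU3.forestTerms (S23 false)) := by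
  decide +kernel

/-- PRD 109 §II Fig. 2: «I[G] = {G}»; 1 = cdefghi ∉ I[G] with external leptons on the main path, 2 = fghi a photonic subgraph inside it.
[cite: Volkov2024PRD109, §II (Fig. 2 example)] -/
def exFig2 : Example :=
  { subs := [⟨"cdefghi", ["c","d","e","f","g","h","i"], false, true, false, false⟩, ⟨"fghi", ["f","g","h","i"], false, false, false, true⟩],
    overlaps := [] }

/-- «A_G (1 − (U₁)_{cdefghi})(1 − (U₀)_{fghi})» is exactly the 2023 forest sum on that data, for either ξ (no I-member other than G occurs).
[cite: Volkov2024PRD109, §II (Fig. 2 example)] -/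
theorem fig2_2023_eq_forest (xi3 : Bool) :
    (expand [[(1, [(0, Op.A)])], [(1, []), (-1, [(1, Op.U1)])], [(1, []), (-1, [(2, Op.U0)])]]).Perm (exFig2.forestTerms (S23 xi3)) := by
  cases xi3 <;> decide +kernel

/-! ### PRD 96, 096018 (2017) §II.B, FIG. 1 (no lepton loops; 𝕴[G] = {G, bcd}) — appended 2026-08-25 by the track-TROPICAL seat V3a
(`pub-qed-trop-v3-lit-1` gen 29; additions only: every declaration above is byte-unchanged). The one worked operator expression of the
2017–2019 reprints not certified above. VERBATIM (arXiv:1705.05800 = PRD 96 §II.B, tex `amm4_mc_arxiv.tex` l.409–428, after eq. (11)):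
«For example, for the graph G from FIG. 1 we have 𝕴[G] = {G, bcd} (subgraphs are specified by enumeration of vertexes). Also, we have two
other vertex-like UV-divergent subgraphs efg, fgh, one electron self-energy subgraph efgh. Thus,
f̃_G = [A_G(1 − U_{bcd}) − (L_G − U_G)A_{bcd}](1 − U_{efgh})(1 − U_{efg} − U_{fgh}) f_G.» The overlap of `efg` and `fgh` (one bracket) is the
kernel-certified forest structure of the transcribed figure, `Volkov2017/SamplingDegree.lean` `maxForests_examples`:
𝔉_max[G] = {{G, bcd, efg, efgh}, {G, bcd, efgh, fgh}}. -/

/-- PRD 96 FIG. 1: 1 = `bcd` (∈ 𝕴[G]), 2 = `efgh` (electron self-energy), 3 = `efg`, 4 = `fgh` (vertex-like, overlapping); no lepton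
loops. [cite: Volkov2017, §II.B (FIG. 1 example, tex l.409–428)] -/
def exPRD96 : Example :=
  { subs := [ ⟨"bcd", ["b","c","d"], true, true, false, false⟩,
              ⟨"efgh", ["e","f","g","h"], false, true, false, false⟩,
              ⟨"efg", ["e","f","g"], false, true, false, false⟩,
              ⟨"fgh", ["f","g","h"], false, true, false, false⟩ ],
    overlaps := [(3, 4)] }

/-- VERBATIM: «[A_G(1 − U_{bcd}) − (L_G − U_G)A_{bcd}](1 − U_{efgh})(1 − U_{efg} − U_{fgh})» (member 0 = G).
[cite: Volkov2017, §II.B (FIG. 1 example, tex l.424–427)] -/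
def figPRD96 : List Factor :=
  [ [(1, [(0, Op.A)]), (-1, [(0, Op.A), (1, Op.U)]), (-1, [(0, Op.LsubU), (1, Op.A)])],
    [(1, []), (-1, [(2, Op.U)])],
    [(1, []), (-1, [(3, Op.U)]), (-1, [(4, Op.U)])] ]

/-- 12 forests (2⁴ − 2²: the subsets of the four proper subgraphs avoiding the overlapping pair) and 18 signed terms on both sides.
[cite: Volkov2017, §II.B (FIG. 1 example)] -/
theorem figPRD96_counts :
    exPRD96.forests.length = 12 ∧ (exPRD96.forestTerms M19).length = 18 ∧ (expand figPRD96).length = 18 := by decide +kernel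

/-- PRD 96's printed operator expression, parentheses removed, is EXACTLY the forest-formula sum (9)–(11) of PRD 96 §II.B (= the 2017–2019
table `M19`) for the printed subgraph data — and equally that of the 2015 table `M15`. [cite: Volkov2017, §II.B eqs. (9)–(11) and the FIG. 1 example] -/
theorem figPRD96_eq_forest :
    (expand figPRD96).Perm (exPRD96.forestTerms M19) ∧ (expand figPRD96).Perm (exPRD96.forestTerms M15) := by decide +kernel

/-- … and, the graph having no lepton loops (ξ = 1), the 2023 table gives the same expansion with U ↦ U₁, (L − U) ↦ (L − U₁).
[cite: Volkov2024PRD109, §II; Volkov2017, §II.B (FIG. 1 example)] -/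
theorem figPRD96_eq_forest23 :
    ((expand figPRD96).map fun t => (t.1, t.2.map fun a => (a.1, embed19 a.2))).Perm (exPRD96.forestTerms (S23 false)) := by
  decide +kernel

end Literature.MathematicalPhysics.QuantumFieldTheory.Volkov2024PRD109
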